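import Literature.Probability.Percolation.InterfaceScalingLimit
import Literature.Probability.Percolation.InterfaceScalingLimitMeasurability
import Literature.Probability.RandomPlanarGeometry.SLEUniquenessInLaw
import Literature.Probability.RandomPlanarGeometry.SLELawOfDrivingProcess
import Literature.Probability.RandomPlanarGeometry.LoewnerDescription
import HarnessLib

/-!
# The triangular exploration path and SLE₆: approximations quantified, and the reduction to the named facts

Topic `Probability/Percolation`, companion of `InterfaceScalingLimit.lean` (crit-perc.S04,
`Literature.Probability.Percolation.convergesInLawToSLE_six_triInterface`: Smirnov 2001, Thm. 2 /
Camia–Newman 2007, Thm. 5 / Werner 2007, Thm. 3.1 — the critical site-percolation exploration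
path on `δ𝕋` converges in law to chordal SLE₆). Written by the literature-prover holding tenure on
that fact after reading the two printed proofs; it records a finding on the statement (which led
to the 2026-08-15 restatement of the fact, §1), spells out the printed statement, and PROVES the
soft layers of its proof down to the named facts of the tree, so that the frontier below
crit-perc.S04 is explicit. Sibling of
`InterfaceScalingLimitDiscretised.lean`, which records the same finding for the bond-`ℤ²`
conjecture crit-perc.S02. Everything in this file is proved; no named fact is introduced.

## 1. The printed theorem quantifies over chosen lattice approximations (statement finding)

Camia–Newman, *Critical percolation exploration path and SLE₆: a proof of convergence*, PTRF 139
(2007), **Theorem 5** (p. 512): "Let `(D, a, b)` be a Jordan domain with two distinct selected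
points on its boundary `∂D`. Then, for Jordan sets `D^δ` from `δ𝓗` with two distinct selected
e-vertices `a^δ, b^δ` on their boundaries `∂D^δ`, such that `(D^δ, a^δ, b^δ) → (D, a, b)` as
`δ → 0`, the percolation exploration path `γ^δ_{D,a,b}` inside `D^δ` from `a^δ` to `b^δ`
converges in distribution to the trace `γ_{D,a,b}` of chordal SLE₆ inside `D` from `a` to `b`, as
`δ → 0`", where `(D^δ, a^δ, b^δ) → (D, a, b)` means (p. 481) that `∂D^δ → ∂D` arcwise **and
`a^δ → a`, `b^δ → b`**; the topology is the sup–inf metric (2), p. 477, on curves modulo monotone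
reparametrisation (the tree's `CurveClass ℂ`). Werner, *Lectures on two-dimensional critical
percolation* (IAS/Park City 16; arXiv:0710.0856), **Theorem 3.1**: "The law of `γ^δ` converges
to the law of chordal SLE(6) from `x` to `c` in the domain `D`", for "a lattice approximation
`D_δ, x_δ, c_δ` of the triplet `D, x, c`" that "we choose" (§3.1), the admissible choices being
spelled out in §3.6: `(a_δ, b_δ, c_δ) → (a, b, c)` and uniform convergence of the discrete
boundary parts to the continuum ones.

The tree's `convergesInLawToSLE_six_triInterface`, as first vendored (until its 2026-08-15
restatement, see below), instead hard-wired ONE scheme, G02's canonical data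
`dobrushinData D δ = ⟨D, δ, (ab), (ba)⟩`, behind the guard
`∀ᶠ δ in 𝓝[>] 0, (dobrushinData D δ).IsAdmissible` — the *canonical-data statement*

  (S04-can)  `∀ D, (∀ᶠ δ in 𝓝[>] 0, (dobrushinData D δ).IsAdmissible) →`
             `  ConvergesInLawToSLE 6 D (triInterface D) (fun _ ↦ triSitePercolation half)`.

Exactly as for the square lattice
(`InterfaceScalingLimitDiscretised.lean`, §2), the discrete arcs of these data are cut out of
the discrete boundary by comparing distances to the closed arcs `(ab)`, `(ba)` with `≤`
(`triDiscreteArc`), so a boundary site equidistant from the two arcs lies in both and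
`IsAdmissible.disjoint` fails: for `DobrushinDomain.unitDisc` (`a = 1`, `b = -1`) the last site
of `δ𝕋` on the non-negative real axis is such a tie at **every** mesh, so the guard is false and
(S04-can) holds vacuously at the disc (evidence file
`CanonicalTriDiscretisationTies.lean`, ledger proposal p26353:
`not_isAdmissible_dobrushinData_unitDisc`, `convergesInLawToSLE_six_triInterface_unitDisc_vacuous`),
and the same lattice-point count defeats the guard along meshes `δ_k → 0⁺` whenever a marked
point is a smooth boundary point in general position.
Moreover, where the guard does hold, the printed hypothesis `a_δ → a`, `b_δ → b` (convergence of
the discrete marked points, here the centres of the two outer `A`–`B` faces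
`DiscreteDobrushin.abFaces`, `triMarkedPoints`) is not known to follow from it for H21's
`triMeshDomain` — the geometric input (GAP) isolated for crit-ising.S18 in `Sweep1Proofs.lean`.

**The printed form, in H21's vocabulary** (here spelled out, as the hypothesis `h` of the two
bridge theorems and as the conclusion of the per-family reductions):

  `∀ (D : DobrushinDomain) (E : ℝ → DiscreteDobrushin), IsTriDiscretisation D E →`
  `  ConvergesInLawToSLE 6 D (fun δ ↦ triInterfaceIn D (E δ)) (fun _ ↦ triSitePercolation half)`,

quantifying over families of admissible triangular discretisations (`IsTriDiscretisation D E`,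
the `δ𝕋` copy of `LatticeModels.IsDiscretisation`: canonical vertex set `triMeshDomain D δ`, mesh
`δ`, arcs of the data converging to `(ab)`, `(ba)` in Hausdorff distance, discrete marked points
converging to `{a, b}`, `IsAdmissible` for all small `δ`). PROVED here: it yields (S04-can)'s
conclusion on every Dobrushin domain whose canonical data are eventually admissible **and** have
convergent marked points (`convergesInLawToSLE_triInterface_of_allDiscretisations`), hence
(S04-can) verbatim under (GAP-tri) for all domains
(`convergesInLawToSLE_six_triInterface_of_allDiscretisations`). **Restatement (2026-08-15,
verdict clean-up of `InterfaceScalingLimit.lean`, ledger p27562).** The named fact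
`convergesInLawToSLE_six_triInterface` has been restated under its name as exactly this printed
form, with the six fields of `IsTriDiscretisation D E` unbundled as successive hypotheses (that
file cannot import the structure from here) and `triInterfaceIn D (E δ) ω` unfolded to
`CurveClass.mk (orientCurve D (explorationCurve (E δ) ω))`: the bundled equivalence is
`convergesInLawToSLE_six_triInterface_iff` below (by definitional unfolding), and
`convergesInLawToSLE_triInterfaceIn_of_isTriDiscretisation` feeds one family. The theorems of §2
which conclude the canonical-data statement state (S04-can) spelled out (it is no longer the
body of a named constant; as a consequence of the fact it is
`convergesInLawToSLE_six_triInterface.triInterface` in `InterfaceScalingLimit.lean`, under the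
extra hypothesis (GAP-tri)).
The printed form is Camia–Newman's Theorem 5 restricted to the sub-family of `δ`-approximations
that H21's `DiscreteDobrushin`/`explorationCurve` can express (vertex set the largest component
`triMeshDomain D δ` of `D ∩ δ𝕋`, boundary colours imposed on its boundary sites, arcs free), hence
implied by the printed statement (Camia–Newman's `∂D^δ → ∂D`, distance (2) between the boundary
arcs as curves, being rendered — as in crit-ising.S17 — by Hausdorff convergence of the arcs of
the data); no family with `IsTriDiscretisation D E` has been constructed in the tree for any `D`
(expected witness for the disc: the two half circles rotated by an angle `≍ δ`), so its
non-vacuity at a given domain is an expectation, whereas vacuity of (S04-can) at the disc is a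
theorem. Both forms are junk-free only under G02's
named fact `LatticeModels.existsUnique_explorationPath` (otherwise `explorationCurve` is the
constant curve `0`).

## 2. The proof architecture, proved down to the tree's named facts

Both printed proofs have the shape (Werner §3.3, p. 20 of the arXiv version: "the laws of
`γ^δ`'s are tight [AB] … It suffices to prove that the law of `γ` is necessarily that of SLE(6)";
Camia–Newman, proof of Thm. 5: "[AB] … Thm. 4 … Thm. 3 … Thm. 2 … the limit is unique"):

* **(T) tightness** of the interface laws as `δ → 0⁺` (Aizenman–Burchard 1999 from RSW/BK; in the
  tree the canonical-data form is the named fact `isTightLaws_map_triInterface`, crit-perc.S26);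
* **(M) measurability** of the interfaces (named fact `aemeasurable_triInterface`, DISCHARGED in
  the tree: `aemeasurable_triInterface_holds`, `InterfaceScalingLimitMeasurability.lean`; for a
  general discrete Dobrushin domain `measurable_triInterfaceIn` below, by the same factorisation
  through the countably-valued exploration walk, `measurable_of_explorationWalk`);
* **(I) identification**: every subsequential weak limit is the chordal SLE₆ law of `(D; a, b)` —
  Camia–Newman Thms 2–4 (spatial Markov property + Cardy's formula for hitting distributions), or
  Werner §3.4–3.8 (Lemmas 3.1–3.3: the limit is a Loewner chain with continuous driving function
  `w`; `X_t = P(𝒜 | γ[0,t])` by Cardy–Smirnov; "`V_t = 0` and `⟨M⟩_t = 6t` … `w(t/6)` is a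
  standard one-dimensional Brownian motion, and `γ` is an SLE(6) process");
* the soft conclusion (Prokhorov + uniqueness of the SLE₆ law), which the tree PROVES once for all
  models: `RandomPlanarGeometry.convergesInLawToSLE_of_isTightAlongMesh'` (`SLEUniquenessInLaw.lean`,
  with `IsSLECurve.map_eq_holds`).

PROVED here: `convergesInLawToSLE_six_triInterface_of_subseqLimits` ((M) ∧ (T) ∧ (I) ⟹ (S04-can),
(M), (T) being the tree's existing named facts and (I) spelled out as a hypothesis),
`convergesInLawToSLE_triInterfaceIn_of_subseqLimits` (the same for one `IsTriDiscretisation`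
family, all three hypotheses spelled out), and the second layer of (I) in Werner's martingale
form: `isSLELaw_six_of_drivingMartingales` — a subsequential limit `ν` a.e. described by the
Loewner evolution through a chordal uniformizing map with a continuous driving process `W`,
`W 0 = 0`, such that `W/√6` is a continuous local martingale with quadratic variation `t`
(Werner §3.8), IS the SLE₆ law, given Lévy's characterisation (`Process.levy_characterisation`)
and the Rohde–Schramm trace theorems for `κ = 6` (`hasSLETrace_of_ne_eight`,
`tendsto_norm_sleTrace_atTop`), by the tree's `isSLELaw_of_isLocalMartingale_driving` — whence the
layer-2 assemblies `convergesInLawToSLE_six_triInterface_of_layer2` and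
`convergesInLawToSLE_triInterfaceIn_of_layer2`; and, (M) being a theorem, the same four
reductions with the measurability hypothesis discharged (primed names, last section). The
percolation-specific inputs (T), (I)/(driving martingales) are hypotheses of the proved
reductions, each a published theorem whose own proof is a theory (AB99; Camia–Newman §§5–7
≈ 30 pp.; Smirnov's theorem, cf. `SmirnovTheorem.lean`). After this file the frontier below
crit-perc.S04 is, family by family: tightness along the mesh (T) (for the canonical data the
named fact `isTightLaws_map_triInterface`), the identification (I) (or Werner's
driving-martingale conclusion together with `Process.levy_characterisation`,
`hasSLETrace_of_ne_eight`, `tendsto_norm_sleTrace_atTop`), and — for non-vacuity — G02's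
`existsUnique_explorationPath` and an `IsTriDiscretisation` family of the domain (§1).

## References

* F. Camia, C. M. Newman, *Critical percolation exploration path and SLE₆: a proof of
  convergence*, Probab. Theory Related Fields 139 (2007) 473–519: §3.1 (metric (2), p. 477),
  §4.1 (exploration path, `δ`-approximations `(D^δ, a^δ, b^δ) → (D, a, b)`, p. 481), Thm. 2
  (p. 486), Thm. 3 (p. 489), Thm. 4 (p. 497), Thm. 5 (p. 512) and its proof (pp. 512–513).
* W. Werner, *Lectures on two-dimensional critical percolation*, IAS/Park City Math. Ser. 16
  (2009) 297–360 (arXiv:0710.0856), Lecture 3: Thm. 3.1, §3.3 (tightness), §§3.4–3.5 (Loewner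
  chains, Lemmas 3.1–3.2), §3.6 (conditions on the approximations), §3.7 (Lemma 3.3), §3.8
  (recognizing SLE(6)).
* S. Smirnov, *Critical percolation in the plane*, C. R. Acad. Sci. Paris 333 (2001) 239–244,
  Thm. 2.
* M. Aizenman, A. Burchard, Duke Math. J. 99 (1999) 419–453, Thms 1.1–1.2.
* P. Billingsley, *Convergence of Probability Measures* (1999), Thm. 5.1 and Corollary.
-/

noncomputable section

open MeasureTheory Filter Topology
open UpperHalfPlane (upperHalfPlaneSet)
open scoped unitInterval NNReal

namespace Literature.Probability.Percolation

section CritPerc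

open LatticeModels

/-! ### The triangular interface in a general discrete Dobrushin domain -/

/-- The **site-percolation interface in the discrete Dobrushin domain `E`** (a triangular-lattice
discretisation of the Dobrushin domain `D`), as a point of the space `CurveClass ℂ` of planar
curves modulo reparametrisation: the class of G02's polygonal hexagonal exploration curve
`explorationCurve E ω` (open / arc-`A` hexagons on its left, closed / arc-`B` hexagons on its
right; junk constant curve `0` unless the exploration path is uniquely defined, which
`IsAdmissible` guarantees under `existsUnique_explorationPath`), re-oriented to run from (near)
`a` to (near) `b` by the endpoint rule `orientCurve D`. For the canonical data
`E = dobrushinData D δ` this is `triInterface D δ` (`triInterfaceIn_dobrushinData`).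
(Camia–Newman 2007, §4.1, p. 480: the percolation exploration path `γ^δ_{D,a,b}` in `D^δ` from
`a^δ` to `b^δ`; Werner 2007, §3.1.) [cite: CamiaNewman2007, §4.1] -/
def triInterfaceIn (D : RandomPlanarGeometry.DobrushinDomain) (E : DiscreteDobrushin)
    (ω : SiteConfig (Site 2)) : RandomPlanarGeometry.CurveClass ℂ :=
  RandomPlanarGeometry.CurveClass.mk (orientCurve D (explorationCurve E ω))

/-- Unfolding `triInterfaceIn`. (Camia–Newman 2007, §4.1.) [cite: CamiaNewman2007, §4.1] -/
theorem triInterfaceIn_apply (D : RandomPlanarGeometry.DobrushinDomain) (E : DiscreteDobrushin)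
    (ω : SiteConfig (Site 2)) :
    triInterfaceIn D E ω =
      RandomPlanarGeometry.CurveClass.mk (orientCurve D (explorationCurve E ω)) :=
  rfl

/-- On the canonical data `dobrushinData D δ` the interface is the tree's `triInterface D δ`
(definitionally). (Smirnov 2001, §2.) [cite: Smirnov2001, §2] -/
@[simp] theorem triInterfaceIn_dobrushinData (D : RandomPlanarGeometry.DobrushinDomain) (δ : ℝ) :
    triInterfaceIn D (dobrushinData D δ) = triInterface D δ :=
  rfl

/-- The trace of the interface is the trace of G02's exploration curve (re-orientation and
passage to `CurveClass` do not change it). (Camia–Newman 2007, §4.1.) [cite: CamiaNewman2007, §4.1] -/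
theorem range_triInterfaceIn (D : RandomPlanarGeometry.DobrushinDomain) (E : DiscreteDobrushin)
    (ω : SiteConfig (Site 2)) :
    (triInterfaceIn D E ω).range = Set.range (explorationCurve E ω) := by
  rw [triInterfaceIn, RandomPlanarGeometry.CurveClass.range_mk, range_orientCurve]

/-- The **discrete marked points** `a_δ`, `b_δ` of the discrete Dobrushin data `E` on `δ𝕋`: the
rescaled centres `δ · hexCenter f` of the outer `A`–`B` faces `f ∈ E.abFaces` (for admissible
data exactly two faces, the endpoints of the exploration path; Camia–Newman's selected
e-vertices `a^δ, b^δ`, §4.1, p. 480, up to half a lattice spacing). (Camia–Newman 2007, §4.1;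
Smirnov 2001, §2.) [cite: CamiaNewman2007, §4.1] -/
def triMarkedPoints (E : DiscreteDobrushin) : Set ℂ :=
  (fun f : HexVertex ↦ (E.δ : ℂ) * hexCenter f) '' E.abFaces

/-- Membership in `triMarkedPoints`, unfolded. (Camia–Newman 2007, §4.1.) [cite: CamiaNewman2007, §4.1] -/
theorem mem_triMarkedPoints_iff {E : DiscreteDobrushin} {z : ℂ} :
    z ∈ triMarkedPoints E ↔ ∃ f ∈ E.abFaces, (E.δ : ℂ) * hexCenter f = z :=
  Set.mem_image _ _ _

/-! ### Triangular discretisations of a Dobrushin domain -/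

/-- `IsTriDiscretisation D E`: the family `E δ` (`δ > 0`) of G02 discrete Dobrushin data on `δ𝕋`
*discretises* the Dobrushin domain `(D; a, b)` in the sense of Camia–Newman's `δ`-approximations
`(D^δ, a^δ, b^δ) → (D, a, b)` (§4.1, p. 481: "`∂D^δ → ∂D`, `a^δ → a` and `b^δ → b`") and of
Werner's §3.6 ("`(a_δ, b_δ, c_δ) → (a, b, c)`"; "for any `z ∈ ∂_j`, the distance of `z` to `∂_j^δ`
converges to `0` … uniformly"), specialised to the canonical vertex set: the domain of the data is
`D.carrier` (so the discrete domain is `triMeshDomain D.carrier δ`) and the mesh is `δ`; the two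
arcs of the data converge to the boundary arcs `(ab) = D.arc 0`, `(ba) = D.arc 1` in the
Hausdorff extended distance (they are free otherwise, so that the tie sites of `triDiscreteArc`
can be avoided); the discrete marked points `triMarkedPoints (E δ)` converge to `{a, b}`; and the
data are admissible (`DiscreteDobrushin.IsAdmissible`: disjoint non-empty discrete arcs covering
`∂Ω_δ`, every `A`–`B` adjacency an edge of `Ω_δ`, exactly two outer `A`–`B` faces) for all small
`δ > 0`, so that G02's `explorationCurve` is the genuine exploration path. This is the `δ𝕋` copy of
`LatticeModels.IsDiscretisation` (`InterfaceSLE.lean`, the reviewed rendering of crit-ising.S17).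
(Camia–Newman 2007, §4.1, p. 481; Werner 2007, §3.6.) [cite: CamiaNewman2007, §4.1, p. 481] -/
structure IsTriDiscretisation (D : RandomPlanarGeometry.DobrushinDomain)
    (E : ℝ → DiscreteDobrushin) : Prop where
  /-- The domain of the data at every mesh is `D`. -/
  Ω_eq : ∀ δ, (E δ).Ω = D.carrier
  /-- The mesh of the data at mesh `δ` is `δ`. -/
  δ_eq : ∀ δ, (E δ).δ = δ
  /-- The open arcs of the data converge to `(ab)` in Hausdorff distance. -/
  tendsto_arcA :
    Tendsto (fun δ ↦ Metric.hausdorffEDist (E δ).arcA (D.arc 0)) (𝓝[>] 0) (𝓝 0)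
  /-- The closed arcs of the data converge to `(ba)` in Hausdorff distance. -/
  tendsto_arcB :
    Tendsto (fun δ ↦ Metric.hausdorffEDist (E δ).arcB (D.arc 1)) (𝓝[>] 0) (𝓝 0)
  /-- The discrete marked points `a_δ`, `b_δ` (centres of the two outer `A`–`B` faces) converge
  to `{a, b}` in Hausdorff distance. -/
  tendsto_triMarkedPoints :
    Tendsto (fun δ ↦ Metric.hausdorffEDist (triMarkedPoints (E δ)) {D.pt 0, D.pt 1})
      (𝓝[>] 0) (𝓝 0)
  /-- The data are admissible for all small positive meshes. -/
  eventually_isAdmissible : ∀ᶠ δ in 𝓝[>] (0 : ℝ), (E δ).IsAdmissible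

namespace IsTriDiscretisation

variable {D : RandomPlanarGeometry.DobrushinDomain} {E : ℝ → DiscreteDobrushin}

/-- For a triangular discretisation, the discrete domain at mesh `δ` is the canonical
`triMeshDomain D δ`. (Smirnov 2001, §2.) [cite: Smirnov2001, §2] -/
theorem triMeshDomain_eq (h : IsTriDiscretisation D E) (δ : ℝ) :
    triMeshDomain (E δ).Ω (E δ).δ = triMeshDomain D.carrier δ := by
  rw [h.Ω_eq, h.δ_eq]

/-- For a triangular discretisation, the data at a small positive mesh have positive mesh.
(Camia–Newman 2007, §4.1.) [cite: CamiaNewman2007, §4.1] -/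
theorem eventually_delta_pos (h : IsTriDiscretisation D E) :
    ∀ᶠ δ in 𝓝[>] (0 : ℝ), 0 < (E δ).δ := by
  filter_upwards [h.eventually_isAdmissible] with δ hδ using hδ.delta_pos

end IsTriDiscretisation

/-! ### Relation with the canonical discretisation -/

/-- The canonical data `dobrushinData D` form an `IsTriDiscretisation` family of `(D; a, b)` iff
they are admissible for all small meshes and their discrete marked points converge to `{a, b}`:
the domain and mesh fields hold by `rfl` and the arcs of the data *are* `(ab)`, `(ba)`
(`hausdorffEDist_self`). (Same computation as `isDiscretisation_dobrushinData_iff` for the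
square-lattice data.) [folklore] -/
theorem isTriDiscretisation_dobrushinData_iff (D : RandomPlanarGeometry.DobrushinDomain) :
    IsTriDiscretisation D (dobrushinData D) ↔
      (∀ᶠ δ in 𝓝[>] (0 : ℝ), (dobrushinData D δ).IsAdmissible) ∧
        Tendsto (fun δ : ℝ ↦ Metric.hausdorffEDist
          (triMarkedPoints (dobrushinData D δ)) {D.pt 0, D.pt 1}) (𝓝[>] 0) (𝓝 0) := by
  refine ⟨fun h ↦ ⟨h.eventually_isAdmissible, h.tendsto_triMarkedPoints⟩, fun h ↦ ?_⟩
  exact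
    { Ω_eq := fun _ ↦ rfl
      δ_eq := fun _ ↦ rfl
      tendsto_arcA := by
        simp only [dobrushinData_arcA, Metric.hausdorffEDist_self]
        exact tendsto_const_nhds
      tendsto_arcB := by
        simp only [dobrushinData_arcB, Metric.hausdorffEDist_self]
        exact tendsto_const_nhds
      tendsto_triMarkedPoints := h.2
      eventually_isAdmissible := h.1 }

/-- **The restated fact, one family at a time.** If crit-perc.S04 holds
(`convergesInLawToSLE_six_triInterface`, the printed statement of Camia–Newman's Theorem 5 over
all discretising families, as restated 2026-08-15), then along every `IsTriDiscretisation` family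
`E` of the Dobrushin domain `D` the interfaces `triInterfaceIn D (E δ)` of critical site
percolation converge in law to chordal SLE₆ in `D`. Definitional unfolding: the six hypotheses
of the fact are the fields of `IsTriDiscretisation D E` and its interface map is
`triInterfaceIn D (E δ)`. PROVED. [cite: CamiaNewman2007, Thm. 5] -/
theorem convergesInLawToSLE_triInterfaceIn_of_isTriDiscretisation
    (h : convergesInLawToSLE_six_triInterface)
    {D : RandomPlanarGeometry.DobrushinDomain} {E : ℝ → DiscreteDobrushin}
    (hE : IsTriDiscretisation D E) :
    RandomPlanarGeometry.ConvergesInLawToSLE 6 D (Ωδ := fun _ ↦ SiteConfig (Site 2))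
      (fun δ ↦ triInterfaceIn D (E δ)) fun _ ↦ triSitePercolation half :=
  h D E hE.Ω_eq hE.δ_eq hE.tendsto_arcA hE.tendsto_arcB hE.tendsto_triMarkedPoints
    hE.eventually_isAdmissible

/-- **crit-perc.S04, bundled form.** The named fact `convergesInLawToSLE_six_triInterface`
(`InterfaceScalingLimit.lean`, hypotheses unbundled there because that file cannot import
`IsTriDiscretisation`) is equivalent to the printed form displayed in the module docstring:
for every Dobrushin domain `D` and every `IsTriDiscretisation` family `E`, the interfaces
`triInterfaceIn D (E δ)` converge in law to chordal SLE₆ in `D`. Both directions are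
definitional repackaging of the structure `IsTriDiscretisation`. PROVED.
[cite: CamiaNewman2007, Thm. 5] -/
theorem convergesInLawToSLE_six_triInterface_iff :
    convergesInLawToSLE_six_triInterface ↔
      ∀ (D : RandomPlanarGeometry.DobrushinDomain) (E : ℝ → DiscreteDobrushin),
        IsTriDiscretisation D E →
        RandomPlanarGeometry.ConvergesInLawToSLE 6 D (Ωδ := fun _ ↦ SiteConfig (Site 2))
          (fun δ ↦ triInterfaceIn D (E δ)) fun _ ↦ triSitePercolation half :=
  ⟨fun h _ _ hE ↦ convergesInLawToSLE_triInterfaceIn_of_isTriDiscretisation h hE,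
    fun h D E h₁ h₂ h₃ h₄ h₅ h₆ ↦ h D E ⟨h₁, h₂, h₃, h₄, h₅, h₆⟩⟩

/-- **The printed statement implies the canonical-data statement where the latter is
meaningful.** Assume Camia–Newman's Theorem 5 / Werner's Theorem 3.1 in H21's vocabulary
(hypothesis `h`, the printed form displayed in the module docstring: for every Dobrushin domain
and every `IsTriDiscretisation` family the interfaces `triInterfaceIn D (E δ)` of critical site
percolation converge in law to chordal SLE₆ in `D`; supplied by the named fact through
`convergesInLawToSLE_six_triInterface_iff`). Then for every Dobrushin domain `D` whose canonical
data `dobrushinData D δ`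
are admissible for all small `δ > 0` *and* have discrete marked points converging to `{a, b}`,
the canonical interface `triInterface D δ` converges in law to chordal SLE₆ in `D` — the
conclusion of the canonical-data statement (S04-can) for `D`. (The second hypothesis on `D` is
the geometric input (GAP) of `Sweep1Proofs.lean`, transposed to `δ𝕋`; it is not known to follow
from the first.) [cite: CamiaNewman2007, Thm. 5] -/
theorem convergesInLawToSLE_triInterface_of_allDiscretisations
    (h : ∀ (D : RandomPlanarGeometry.DobrushinDomain) (E : ℝ → DiscreteDobrushin),
      IsTriDiscretisation D E →
      RandomPlanarGeometry.ConvergesInLawToSLE 6 D (Ωδ := fun _ ↦ SiteConfig (Site 2))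
        (fun δ ↦ triInterfaceIn D (E δ)) fun _ ↦ triSitePercolation half)
    (D : RandomPlanarGeometry.DobrushinDomain)
    (hadm : ∀ᶠ δ in 𝓝[>] (0 : ℝ), (dobrushinData D δ).IsAdmissible)
    (hab : Tendsto (fun δ : ℝ ↦ Metric.hausdorffEDist
      (triMarkedPoints (dobrushinData D δ)) {D.pt 0, D.pt 1}) (𝓝[>] 0) (𝓝 0)) :
    RandomPlanarGeometry.ConvergesInLawToSLE 6 D (Ωδ := fun _ ↦ SiteConfig (Site 2))
      (triInterface D) fun _ ↦ triSitePercolation half :=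
  h D (dobrushinData D) ((isTriDiscretisation_dobrushinData_iff D).2 ⟨hadm, hab⟩)

/-- In particular, under (GAP-tri) for all domains — eventually admissible canonical data have
convergent discrete marked points — the printed statement (hypothesis `h`) implies the
canonical-data statement (S04-can) of the module docstring verbatim (the body of
`convergesInLawToSLE_six_triInterface` before its 2026-08-15 restatement, spelled out).
[cite: CamiaNewman2007, Thm. 5] -/
theorem convergesInLawToSLE_six_triInterface_of_allDiscretisations
    (h : ∀ (D : RandomPlanarGeometry.DobrushinDomain) (E : ℝ → DiscreteDobrushin),
      IsTriDiscretisation D E →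
      RandomPlanarGeometry.ConvergesInLawToSLE 6 D (Ωδ := fun _ ↦ SiteConfig (Site 2))
        (fun δ ↦ triInterfaceIn D (E δ)) fun _ ↦ triSitePercolation half)
    (hgap : ∀ D : RandomPlanarGeometry.DobrushinDomain,
      (∀ᶠ δ in 𝓝[>] (0 : ℝ), (dobrushinData D δ).IsAdmissible) →
        Tendsto (fun δ : ℝ ↦ Metric.hausdorffEDist
          (triMarkedPoints (dobrushinData D δ)) {D.pt 0, D.pt 1}) (𝓝[>] 0) (𝓝 0)) :
    ∀ D : RandomPlanarGeometry.DobrushinDomain,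
      (∀ᶠ δ in 𝓝[>] (0 : ℝ), (dobrushinData D δ).IsAdmissible) →
      RandomPlanarGeometry.ConvergesInLawToSLE 6 D (Ωδ := fun _ ↦ SiteConfig (Site 2))
        (triInterface D) fun _ ↦ triSitePercolation half :=
  fun D hadm ↦ convergesInLawToSLE_triInterface_of_allDiscretisations h D hadm (hgap D hadm)

/-! ### Layer 1: tightness, measurability and identification of subsequential limits -/

/-- **S04 from its three printed layers (canonical data).** The canonical-data statement
(S04-can) of the module docstring (spelled out; the body of `convergesInLawToSLE_six_triInterface`
before its 2026-08-15 restatement) follows from: (M) a.e.-measurability of the interfaces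
(the tree's named fact `aemeasurable_triInterface`), (T) tightness of their laws for `δ ∈ (0, 1]`
(the tree's named fact `isTightLaws_map_triInterface`, Aizenman–Burchard, crit-perc.S26), and
(I) identification — for every Dobrushin domain with eventually admissible canonical data, every
probability measure on `CurveClass ℂ` which is a subsequential weak limit of the interface laws
(`IsSubseqLimitLaw`) is the chordal SLE₆ law of `(D; a, b)` (Camia–Newman 2007, Thms 2–4 with
Thm. 3 = Smirnov's theorem; Werner 2007, §§3.4–3.8). The implication is Prokhorov's theorem and
uniqueness of the SLE₆ law, the tree's `convergesInLawToSLE_of_isTightLaws'` (Werner §3.3: "It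
suffices to prove that the law of `γ` is necessarily that of SLE(6)"; Camia–Newman, proof of
Thm. 5, p. 513: "we can deduce from Theorem 2 that the limit is unique"). PROVED.
[cite: Werner2007, §3.3] [cite: CamiaNewman2007, proof of Thm. 5] -/
theorem convergesInLawToSLE_six_triInterface_of_subseqLimits
    (hM : aemeasurable_triInterface) (hT : isTightLaws_map_triInterface)
    (hI : ∀ D : RandomPlanarGeometry.DobrushinDomain,
      (∀ᶠ δ in 𝓝[>] (0 : ℝ), (dobrushinData D δ).IsAdmissible) →
      ∀ μ : Measure (RandomPlanarGeometry.CurveClass ℂ), IsProbabilityMeasure μ →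
        RandomPlanarGeometry.IsSubseqLimitLaw (Ωδ := fun _ ↦ SiteConfig (Site 2))
          (triInterface D) (fun _ ↦ triSitePercolation half) μ →
        RandomPlanarGeometry.IsSLELaw 6 D μ) :
    ∀ D : RandomPlanarGeometry.DobrushinDomain,
      (∀ᶠ δ in 𝓝[>] (0 : ℝ), (dobrushinData D δ).IsAdmissible) →
      RandomPlanarGeometry.ConvergesInLawToSLE 6 D (Ωδ := fun _ ↦ SiteConfig (Site 2))
        (triInterface D) fun _ ↦ triSitePercolation half :=
  fun D hD ↦ RandomPlanarGeometry.convergesInLawToSLE_of_isTightLaws'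
    (Eventually.of_forall fun δ ↦ hM D δ) (hT D hD) (hI D hD)

/-- **Camia–Newman's Theorem 5 for one approximating family, from its three printed layers.**
For a Dobrushin domain `D` and a family `E` of discrete Dobrushin data on `δ𝕋` (typically an
`IsTriDiscretisation` family), the interfaces `triInterfaceIn D (E δ)` of critical site
percolation converge in law to chordal SLE₆ in `D` as soon as: (M) they are a.e.-measurable under
`P_{1/2}` for all small `δ` (Aizenman–Burchard 1999, §2.1: interface laws as Borel measures on
curve space; here a finite-range map with cylinder fibres); (T) they are tight as `δ → 0⁺`
(`IsTightAlongMesh`; Aizenman–Burchard 1999, Thm. 1.2, from RSW/BK — Werner §3.3, Camia–Newman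
§7 "[2]"); (I) every subsequential weak limit is the chordal SLE₆ law of `(D; a, b)`
(Camia–Newman Thms 2–4; Werner §§3.4–3.8). Prokhorov + uniqueness of the SLE₆ law
(`convergesInLawToSLE_of_isTightAlongMesh'`). PROVED.
[cite: CamiaNewman2007, proof of Thm. 5] [cite: Werner2007, §3.3] -/
theorem convergesInLawToSLE_triInterfaceIn_of_subseqLimits
    (D : RandomPlanarGeometry.DobrushinDomain) (E : ℝ → DiscreteDobrushin)
    (hM : ∀ᶠ δ in 𝓝[>] (0 : ℝ), AEMeasurable (triInterfaceIn D (E δ)) (triSitePercolation half))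
    (hT : RandomPlanarGeometry.IsTightAlongMesh (Ωδ := fun _ ↦ SiteConfig (Site 2))
      (fun δ ↦ triInterfaceIn D (E δ)) fun _ ↦ triSitePercolation half)
    (hI : ∀ μ : Measure (RandomPlanarGeometry.CurveClass ℂ), IsProbabilityMeasure μ →
      RandomPlanarGeometry.IsSubseqLimitLaw (Ωδ := fun _ ↦ SiteConfig (Site 2))
        (fun δ ↦ triInterfaceIn D (E δ)) (fun _ ↦ triSitePercolation half) μ →
      RandomPlanarGeometry.IsSLELaw 6 D μ) :
    RandomPlanarGeometry.ConvergesInLawToSLE 6 D (Ωδ := fun _ ↦ SiteConfig (Site 2))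
      (fun δ ↦ triInterfaceIn D (E δ)) fun _ ↦ triSitePercolation half :=
  RandomPlanarGeometry.convergesInLawToSLE_of_isTightAlongMesh' hM hT hI

/-! ### Layer 2 of (I): Werner's driving-function martingale and Lévy's characterisation -/

/-- `6 ≠ 8` in `ℝ≥0` (the percolation SLE parameter is in the Rohde–Schramm range). [folklore] -/
theorem six_ne_eight : (6 : ℝ≥0) ≠ 8 := by norm_num

/-- `0 < 6` in `ℝ≥0`. [folklore] -/
theorem six_pos : (0 : ℝ≥0) < 6 := by norm_num

/-- **Recognizing SLE(6)** (Werner 2007, §3.8; Camia–Newman 2007, Thm. 2 in driving-function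
form). Let `ν` be a probability measure on `CurveClass ℂ` — typically a subsequential weak limit
of the exploration-path laws — and suppose, as Werner proves for such limits (§§3.4–3.5,
Lemmas 3.1–3.2: "`Φ(K_t)` is a Loewner chain in the upper half-plane generated by a random
continuous function `w_t`"; §3.8: "`V_t = 0` and `⟨M⟩_t = 6t` for all `t ≥ 0`. In other words,
`w(t/6)` is a standard one-dimensional Brownian motion"), that for some chordal uniformizing map
`φ` of `(D; a, b)`, some process `W : CurveClass ℂ → ([0, ∞) → ℝ)` with measurable marginals and
some filtration: `ν`-a.e. curve class `c` is described by the Loewner evolution through `φ` with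
the (continuous) driving function `W c`, `W c 0 = 0` (`IsLoewnerDescribed`), and `W/√6` is a
continuous local martingale with quadratic variation `⟨W/√6⟩_t = t` (`IsLocalMartingale`,
`HasQuadraticVariation` — the Lévy format of "`V = 0`, `⟨M⟩_t = 6t`"). Then `ν` is the chordal
SLE₆ law of `(D; a, b)` (`IsSLELaw 6 D ν`), given Lévy's characterisation of Brownian motion
(`Process.levy_characterisation`, the step "`w(t/6)` is a standard Brownian motion") and the
Rohde–Schramm trace theorems for `κ = 6` (`hasSLETrace_of_ne_eight`, Thm. 5.1;
`tendsto_norm_sleTrace_atTop`, Thm. 7.1), which H21's notion of the SLE law presupposes. PROVED,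
by the tree's `isSLELaw_of_isLocalMartingale_driving`. [cite: Werner2007, §3.8] -/
theorem isSLELaw_six_of_drivingMartingales
    (hLevy : Process.levy_characterisation (Ω := RandomPlanarGeometry.CurveClass ℂ)
      (m := inferInstance))
    (hne : RandomPlanarGeometry.hasSLETrace_of_ne_eight)
    (htr : RandomPlanarGeometry.tendsto_norm_sleTrace_atTop)
    {D : RandomPlanarGeometry.DobrushinDomain}
    {φ : RandomPlanarGeometry.ConformalEquiv upperHalfPlaneSet D.carrier}
    (hφ : D.IsChordalUniformizing φ)
    {ν : Measure (RandomPlanarGeometry.CurveClass ℂ)} [IsProbabilityMeasure ν]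
    {W : RandomPlanarGeometry.CurveClass ℂ → ℝ≥0 → ℝ} (hWm : ∀ t, Measurable fun c ↦ W c t)
    (hW : ∀ᵐ c ∂ν, RandomPlanarGeometry.IsLoewnerDescribed φ c (W c) ∧ W c 0 = 0)
    {𝓕 : Filtration ℝ≥0 (inferInstance : MeasurableSpace (RandomPlanarGeometry.CurveClass ℂ))}
    (hloc : RandomPlanarGeometry.IsLocalMartingale (fun t c ↦ (Real.sqrt 6)⁻¹ * W c t) 𝓕 ν)
    (hQ : Process.HasQuadraticVariation (fun t c ↦ (Real.sqrt 6)⁻¹ * W c t)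
      (fun t _ ↦ (t : ℝ)) 𝓕 ν) :
    RandomPlanarGeometry.IsSLELaw 6 D ν := by
  refine RandomPlanarGeometry.isSLELaw_of_isLocalMartingale_driving (hne six_ne_eight) six_pos
    htr hLevy hφ hWm ?_ ?_ hloc ?_ ?_
  · filter_upwards [hW] with c hc using hc.2
  · filter_upwards [hW] with c hc using hc.1.continuous
  · have hsq : Real.sqrt ((6 : ℝ≥0) : ℝ) = Real.sqrt 6 := by norm_num
    simpa only [hsq] using hQ
  · filter_upwards [hW] with c hc
    obtain ⟨-, γ, hγ, c', hc', hI⟩ := hc.1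
    exact ⟨γ, hγ, c', hc', hI⟩

/-- **S04 (canonical data) from its second layer.** The canonical-data statement (S04-can)
follows from the tree's named facts `aemeasurable_triInterface` (M), `isTightLaws_map_triInterface`
(T, Aizenman–Burchard), Lévy's characterisation, the Rohde–Schramm trace theorems for `κ = 6`,
and Werner's conclusion about subsequential limits (§§3.4–3.8, spelled out as the hypothesis
`hW`): for every Dobrushin domain with eventually admissible canonical data and every probability
measure `ν` which is a subsequential weak limit of the laws of `triInterface D δ` under `P_{1/2}`,
there are a chordal uniformizing map `φ`, a process `W` with measurable marginals and a filtration
such that `ν`-a.e. `c` is Loewner-described through `φ` by `W c` with `W c 0 = 0` and `W/√6` is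
a continuous local martingale with quadratic variation `t`. PROVED
(`convergesInLawToSLE_six_triInterface_of_subseqLimits` + `isSLELaw_six_of_drivingMartingales`).
[cite: Werner2007, Thm. 3.1, §§3.3–3.8] -/
theorem convergesInLawToSLE_six_triInterface_of_layer2
    (hM : aemeasurable_triInterface) (hT : isTightLaws_map_triInterface)
    (hLevy : Process.levy_characterisation (Ω := RandomPlanarGeometry.CurveClass ℂ)
      (m := inferInstance))
    (hne : RandomPlanarGeometry.hasSLETrace_of_ne_eight)
    (htr : RandomPlanarGeometry.tendsto_norm_sleTrace_atTop)
    (hW : ∀ D : RandomPlanarGeometry.DobrushinDomain,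
      (∀ᶠ δ in 𝓝[>] (0 : ℝ), (dobrushinData D δ).IsAdmissible) →
      ∀ ν : Measure (RandomPlanarGeometry.CurveClass ℂ), IsProbabilityMeasure ν →
        RandomPlanarGeometry.IsSubseqLimitLaw (Ωδ := fun _ ↦ SiteConfig (Site 2))
          (triInterface D) (fun _ ↦ triSitePercolation half) ν →
        ∃ (φ : RandomPlanarGeometry.ConformalEquiv upperHalfPlaneSet D.carrier)
          (W : RandomPlanarGeometry.CurveClass ℂ → ℝ≥0 → ℝ)
          (𝓕 : Filtration ℝ≥0 (inferInstance : MeasurableSpace (RandomPlanarGeometry.CurveClass ℂ))),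
          D.IsChordalUniformizing φ ∧ (∀ t, Measurable fun c ↦ W c t) ∧
          (∀ᵐ c ∂ν, RandomPlanarGeometry.IsLoewnerDescribed φ c (W c) ∧ W c 0 = 0) ∧
          RandomPlanarGeometry.IsLocalMartingale (fun t c ↦ (Real.sqrt 6)⁻¹ * W c t) 𝓕 ν ∧
          Process.HasQuadraticVariation (fun t c ↦ (Real.sqrt 6)⁻¹ * W c t)
            (fun t _ ↦ (t : ℝ)) 𝓕 ν) :
    ∀ D : RandomPlanarGeometry.DobrushinDomain,
      (∀ᶠ δ in 𝓝[>] (0 : ℝ), (dobrushinData D δ).IsAdmissible) →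
      RandomPlanarGeometry.ConvergesInLawToSLE 6 D (Ωδ := fun _ ↦ SiteConfig (Site 2))
        (triInterface D) fun _ ↦ triSitePercolation half := by
  refine convergesInLawToSLE_six_triInterface_of_subseqLimits hM hT fun D hD ν hν hlim ↦ ?_
  obtain ⟨φ, W, 𝓕, hφ, hWm, hae, hloc, hQ⟩ := hW D hD ν hν hlim
  exact isSLELaw_six_of_drivingMartingales hLevy hne htr hφ hWm hae hloc hQ

/-- **Camia–Newman's Theorem 5 for one approximating family, from its second layer**: the
interfaces `triInterfaceIn D (E δ)` converge in law to chordal SLE₆ in `D` given their eventual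
a.e.-measurability (M) and tightness along the mesh (T), Lévy's characterisation, the
Rohde–Schramm trace theorems for `κ = 6`, and Werner's driving-function conclusion about the
subsequential weak limits of the family (§§3.4–3.8, hypothesis `hW` as in
`convergesInLawToSLE_six_triInterface_of_layer2`). PROVED.
[cite: Werner2007, Thm. 3.1, §§3.3–3.8] [cite: CamiaNewman2007, Thm. 5] -/
theorem convergesInLawToSLE_triInterfaceIn_of_layer2
    (D : RandomPlanarGeometry.DobrushinDomain) (E : ℝ → DiscreteDobrushin)
    (hM : ∀ᶠ δ in 𝓝[>] (0 : ℝ), AEMeasurable (triInterfaceIn D (E δ)) (triSitePercolation half))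
    (hT : RandomPlanarGeometry.IsTightAlongMesh (Ωδ := fun _ ↦ SiteConfig (Site 2))
      (fun δ ↦ triInterfaceIn D (E δ)) fun _ ↦ triSitePercolation half)
    (hLevy : Process.levy_characterisation (Ω := RandomPlanarGeometry.CurveClass ℂ)
      (m := inferInstance))
    (hne : RandomPlanarGeometry.hasSLETrace_of_ne_eight)
    (htr : RandomPlanarGeometry.tendsto_norm_sleTrace_atTop)
    (hW : ∀ ν : Measure (RandomPlanarGeometry.CurveClass ℂ), IsProbabilityMeasure ν →
      RandomPlanarGeometry.IsSubseqLimitLaw (Ωδ := fun _ ↦ SiteConfig (Site 2))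
        (fun δ ↦ triInterfaceIn D (E δ)) (fun _ ↦ triSitePercolation half) ν →
      ∃ (φ : RandomPlanarGeometry.ConformalEquiv upperHalfPlaneSet D.carrier)
        (W : RandomPlanarGeometry.CurveClass ℂ → ℝ≥0 → ℝ)
        (𝓕 : Filtration ℝ≥0 (inferInstance : MeasurableSpace (RandomPlanarGeometry.CurveClass ℂ))),
        D.IsChordalUniformizing φ ∧ (∀ t, Measurable fun c ↦ W c t) ∧
        (∀ᵐ c ∂ν, RandomPlanarGeometry.IsLoewnerDescribed φ c (W c) ∧ W c 0 = 0) ∧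
        RandomPlanarGeometry.IsLocalMartingale (fun t c ↦ (Real.sqrt 6)⁻¹ * W c t) 𝓕 ν ∧
        Process.HasQuadraticVariation (fun t c ↦ (Real.sqrt 6)⁻¹ * W c t)
          (fun t _ ↦ (t : ℝ)) 𝓕 ν) :
    RandomPlanarGeometry.ConvergesInLawToSLE 6 D (Ωδ := fun _ ↦ SiteConfig (Site 2))
      (fun δ ↦ triInterfaceIn D (E δ)) fun _ ↦ triSitePercolation half := by
  refine convergesInLawToSLE_triInterfaceIn_of_subseqLimits D E hM hT fun ν hν hlim ↦ ?_
  obtain ⟨φ, W, 𝓕, hφ, hWm, hae, hloc, hQ⟩ := hW ν hν hlim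
  exact isSLELaw_six_of_drivingMartingales hLevy hne htr hφ hWm hae hloc hQ

/-! ### (M) discharged: measurability of the interface in any discrete Dobrushin domain -/

/-- **The triangular interface in any discrete Dobrushin domain is measurable**
(`triInterfaceIn D E : SiteConfig (Site 2) → CurveClass ℂ`, Borel σ-algebra on the target), for
every Dobrushin domain `D` and every `E` — no admissibility, boundedness or `δ > 0` hypothesis:
it is a function of the countably-valued exploration walk `explorationWalk E`, whose fibres are
measurable (`measurable_of_explorationWalk`, `InterfaceScalingLimitMeasurability.lean`).
(Aizenman–Burchard 1999, §2.1: interface laws as Borel measures on curve space; Camia–Newman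
2007, §4.1, p. 481: "`P` induces a probability measure `μ^δ_{D,a,b}` on exploration paths".)
[cite: AizenmanBurchard1999, §2.1] -/
theorem measurable_triInterfaceIn (D : RandomPlanarGeometry.DobrushinDomain) (E : DiscreteDobrushin) :
    Measurable (triInterfaceIn D E) :=
  measurable_of_explorationWalk E fun ω ω' h ↦ by
    rw [triInterfaceIn, triInterfaceIn, explorationCurve_congr h]

/-- Hence the interface is a.e.-measurable under any law, in particular under critical site
percolation, for every family of discrete Dobrushin domains and every mesh: hypothesis (M) of
the reductions above holds unconditionally. [cite: AizenmanBurchard1999, §2.1] -/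
theorem aemeasurable_triInterfaceIn (D : RandomPlanarGeometry.DobrushinDomain) (E : DiscreteDobrushin)
    (P : Measure (SiteConfig (Site 2))) : AEMeasurable (triInterfaceIn D E) P :=
  (measurable_triInterfaceIn D E).aemeasurable

/-- **S04 (canonical data) from tightness and identification alone** — layer 1 with (M)
discharged by `aemeasurable_triInterface_holds`: the canonical-data statement (S04-can)
follows from the Aizenman–Burchard tightness fact `isTightLaws_map_triInterface` (T) and the
identification (I) of every subsequential weak limit of the canonical interface laws as the
chordal SLE₆ law. PROVED. [cite: Werner2007, §3.3] [cite: CamiaNewman2007, proof of Thm. 5] -/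
theorem convergesInLawToSLE_six_triInterface_of_subseqLimits'
    (hT : isTightLaws_map_triInterface)
    (hI : ∀ D : RandomPlanarGeometry.DobrushinDomain,
      (∀ᶠ δ in 𝓝[>] (0 : ℝ), (dobrushinData D δ).IsAdmissible) →
      ∀ μ : Measure (RandomPlanarGeometry.CurveClass ℂ), IsProbabilityMeasure μ →
        RandomPlanarGeometry.IsSubseqLimitLaw (Ωδ := fun _ ↦ SiteConfig (Site 2))
          (triInterface D) (fun _ ↦ triSitePercolation half) μ →
        RandomPlanarGeometry.IsSLELaw 6 D μ) :
    ∀ D : RandomPlanarGeometry.DobrushinDomain,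
      (∀ᶠ δ in 𝓝[>] (0 : ℝ), (dobrushinData D δ).IsAdmissible) →
      RandomPlanarGeometry.ConvergesInLawToSLE 6 D (Ωδ := fun _ ↦ SiteConfig (Site 2))
        (triInterface D) fun _ ↦ triSitePercolation half :=
  convergesInLawToSLE_six_triInterface_of_subseqLimits aemeasurable_triInterface_holds hT hI

/-- **Camia–Newman's Theorem 5 for one approximating family, from tightness and identification
alone** — layer 1 with (M) discharged by `aemeasurable_triInterfaceIn`. PROVED.
[cite: CamiaNewman2007, proof of Thm. 5] [cite: Werner2007, §3.3] -/
theorem convergesInLawToSLE_triInterfaceIn_of_subseqLimits'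
    (D : RandomPlanarGeometry.DobrushinDomain) (E : ℝ → DiscreteDobrushin)
    (hT : RandomPlanarGeometry.IsTightAlongMesh (Ωδ := fun _ ↦ SiteConfig (Site 2))
      (fun δ ↦ triInterfaceIn D (E δ)) fun _ ↦ triSitePercolation half)
    (hI : ∀ μ : Measure (RandomPlanarGeometry.CurveClass ℂ), IsProbabilityMeasure μ →
      RandomPlanarGeometry.IsSubseqLimitLaw (Ωδ := fun _ ↦ SiteConfig (Site 2))
        (fun δ ↦ triInterfaceIn D (E δ)) (fun _ ↦ triSitePercolation half) μ →
      RandomPlanarGeometry.IsSLELaw 6 D μ) :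
    RandomPlanarGeometry.ConvergesInLawToSLE 6 D (Ωδ := fun _ ↦ SiteConfig (Site 2))
      (fun δ ↦ triInterfaceIn D (E δ)) fun _ ↦ triSitePercolation half :=
  convergesInLawToSLE_triInterfaceIn_of_subseqLimits D E
    (Eventually.of_forall fun δ ↦ aemeasurable_triInterfaceIn D (E δ) _) hT hI

/-- **S04 (canonical data) from its second layer, (M) discharged**: the canonical-data statement
(S04-can) from `isTightLaws_map_triInterface`, Lévy's
characterisation, the Rohde–Schramm trace theorems for `κ = 6` and Werner's driving-martingale
conclusion about subsequential limits (hypothesis `hW`). PROVED.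
[cite: Werner2007, Thm. 3.1, §§3.3–3.8] -/
theorem convergesInLawToSLE_six_triInterface_of_layer2'
    (hT : isTightLaws_map_triInterface)
    (hLevy : Process.levy_characterisation (Ω := RandomPlanarGeometry.CurveClass ℂ)
      (m := inferInstance))
    (hne : RandomPlanarGeometry.hasSLETrace_of_ne_eight)
    (htr : RandomPlanarGeometry.tendsto_norm_sleTrace_atTop)
    (hW : ∀ D : RandomPlanarGeometry.DobrushinDomain,
      (∀ᶠ δ in 𝓝[>] (0 : ℝ), (dobrushinData D δ).IsAdmissible) →
      ∀ ν : Measure (RandomPlanarGeometry.CurveClass ℂ), IsProbabilityMeasure ν →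
        RandomPlanarGeometry.IsSubseqLimitLaw (Ωδ := fun _ ↦ SiteConfig (Site 2))
          (triInterface D) (fun _ ↦ triSitePercolation half) ν →
        ∃ (φ : RandomPlanarGeometry.ConformalEquiv upperHalfPlaneSet D.carrier)
          (W : RandomPlanarGeometry.CurveClass ℂ → ℝ≥0 → ℝ)
          (𝓕 : Filtration ℝ≥0 (inferInstance : MeasurableSpace (RandomPlanarGeometry.CurveClass ℂ))),
          D.IsChordalUniformizing φ ∧ (∀ t, Measurable fun c ↦ W c t) ∧
          (∀ᵐ c ∂ν, RandomPlanarGeometry.IsLoewnerDescribed φ c (W c) ∧ W c 0 = 0) ∧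
          RandomPlanarGeometry.IsLocalMartingale (fun t c ↦ (Real.sqrt 6)⁻¹ * W c t) 𝓕 ν ∧
          Process.HasQuadraticVariation (fun t c ↦ (Real.sqrt 6)⁻¹ * W c t)
            (fun t _ ↦ (t : ℝ)) 𝓕 ν) :
    ∀ D : RandomPlanarGeometry.DobrushinDomain,
      (∀ᶠ δ in 𝓝[>] (0 : ℝ), (dobrushinData D δ).IsAdmissible) →
      RandomPlanarGeometry.ConvergesInLawToSLE 6 D (Ωδ := fun _ ↦ SiteConfig (Site 2))
        (triInterface D) fun _ ↦ triSitePercolation half :=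
  convergesInLawToSLE_six_triInterface_of_layer2 aemeasurable_triInterface_holds hT hLevy hne htr hW

/-- **Camia–Newman's Theorem 5 for one approximating family, from its second layer, (M)
discharged.** PROVED. [cite: Werner2007, Thm. 3.1, §§3.3–3.8] [cite: CamiaNewman2007, Thm. 5] -/
theorem convergesInLawToSLE_triInterfaceIn_of_layer2'
    (D : RandomPlanarGeometry.DobrushinDomain) (E : ℝ → DiscreteDobrushin)
    (hT : RandomPlanarGeometry.IsTightAlongMesh (Ωδ := fun _ ↦ SiteConfig (Site 2))
      (fun δ ↦ triInterfaceIn D (E δ)) fun _ ↦ triSitePercolation half)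
    (hLevy : Process.levy_characterisation (Ω := RandomPlanarGeometry.CurveClass ℂ)
      (m := inferInstance))
    (hne : RandomPlanarGeometry.hasSLETrace_of_ne_eight)
    (htr : RandomPlanarGeometry.tendsto_norm_sleTrace_atTop)
    (hW : ∀ ν : Measure (RandomPlanarGeometry.CurveClass ℂ), IsProbabilityMeasure ν →
      RandomPlanarGeometry.IsSubseqLimitLaw (Ωδ := fun _ ↦ SiteConfig (Site 2))
        (fun δ ↦ triInterfaceIn D (E δ)) (fun _ ↦ triSitePercolation half) ν →
      ∃ (φ : RandomPlanarGeometry.ConformalEquiv upperHalfPlaneSet D.carrier)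
        (W : RandomPlanarGeometry.CurveClass ℂ → ℝ≥0 → ℝ)
        (𝓕 : Filtration ℝ≥0 (inferInstance : MeasurableSpace (RandomPlanarGeometry.CurveClass ℂ))),
        D.IsChordalUniformizing φ ∧ (∀ t, Measurable fun c ↦ W c t) ∧
        (∀ᵐ c ∂ν, RandomPlanarGeometry.IsLoewnerDescribed φ c (W c) ∧ W c 0 = 0) ∧
        RandomPlanarGeometry.IsLocalMartingale (fun t c ↦ (Real.sqrt 6)⁻¹ * W c t) 𝓕 ν ∧
        Process.HasQuadraticVariation (fun t c ↦ (Real.sqrt 6)⁻¹ * W c t)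
          (fun t _ ↦ (t : ℝ)) 𝓕 ν) :
    RandomPlanarGeometry.ConvergesInLawToSLE 6 D (Ωδ := fun _ ↦ SiteConfig (Site 2))
      (fun δ ↦ triInterfaceIn D (E δ)) fun _ ↦ triSitePercolation half :=
  convergesInLawToSLE_triInterfaceIn_of_layer2 D E
    (Eventually.of_forall fun δ ↦ aemeasurable_triInterfaceIn D (E δ) _) hT hLevy hne htr hW

end CritPerc

end Literature.Probability.Percolation
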